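import Mathlib
import HarnessLib
import Literature.NumberTheory.LFunctions.BourgainDecouplingMeanValue

/-!
# Bourgain's mean value `A₆(N, δ, Δ)`: integrability, the rescaling, and Corollary 3 ⟺ Theorem 2

Topic `Literature/NumberTheory/LFunctions`. Sibling proof file of `BourgainDecouplingMeanValue.lean`
(Huxley's twelfth-moment mean value `Literature.NumberTheory.LFunctions.bourgainA6` in the
normalisation of Bourgain, *J. Amer. Math. Soc.* 30 (2017), Corollary 3, eq. (2.28), and the
endpoint case Theorem 2, eq. (2.12)). It records the standing evidence that
`Literature.NumberTheory.LFunctions.bourgainA6` is a genuine Lebesgue integral and not Mathlib's junk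
value `0` of a non-integrable integrand: the sum
`x ↦ ∑_{1 ≤ n ≤ N} e(n x₁ + n² x₂ + δ⁻¹ (n/N)^{3/2} x₃ + Δ⁻¹ (n/N)^{1/2} x₄)` is continuous on `ℝ⁴`,
`|∑|¹²` is integrable on the compact box `[0,1]² × [-1,1]²`, and `A₆(1, δ, Δ) = 4` (one
unimodular term, box of measure `4`); and it proves the paper's "Theorem 2 implies Corollary 3"
(the rescaling `x₃ = δ y₃`, `x₄ = Δ y₄`), hence the equivalence of the two printed statements.

Both printed statements are written out EXPLICITLY in this file (as hypothesis / conclusion of the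
proved implications), not through a named fact: their common content — Bourgain's decoupling
theorem (Thm 1 of the paper, `d = 4`, a bootstrap over the Bourgain–Demeter `L⁶` decoupling (1.5)
for planar curves [B-D1]) plus the multilinear-to-linear induction on scales of [B-G] (§3,
(2.24)–(2.27)); none of this (Fourier restriction / decoupling, wave packets, multilinear Kakeya)
is available in Mathlib — is theory-sized, and in this tree it is part of the obligation carried by
`Literature.NumberTheory.LFunctions.Bourgain2017_theorem4_log` (step 3, eq. (3.10), of the printed
proof of Theorem 4; see `BourgainTheorem4.lean`), the fact on which the discharge of Bourgain's
Theorem 5 `Literature.NumberTheory.LFunctions.bourgain_subconvexity` rests.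

* `continuous_bourgainA6Sum`, `integrableOn_bourgainA6_integrand`, `bourgainA6_one` — PROVED.
* `bourgainA6_eq_mul_setIntegral` — PROVED: the rescaling identity
  `A₆(N, δ, Δ) = δ Δ ∫_{[0,1]² × [-1/δ,1/δ] × [-1/Δ,1/Δ]} |∑ e(n y₁ + n² y₂ + (n/N)^{3/2} y₃ + (n/N)^{1/2} y₄)|¹² dy`
  (`δ, Δ > 0`), with `bourgainA6_setIntegral_mono` (monotone in the box) and
  `bourgainA6_setIntegral_endpoint` (`= N³ A₆(N, 1/N², 1/N)` at `(1/N², 1/N)`).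
* `Bourgain2017_corollary3_of_theorem2`, `Bourgain2017_corollary3_iff_theorem2` — PROVED: the
  paper's "Theorem 2 implies Corollary 3" (Cor. 3 (2.28),
  `∀ ε > 0, ∃ C, ∀ N ≥ 1, ∀ δ ∈ [1/N², 1], Δ ∈ [1/N, 1], A₆(N, δ, Δ) ≤ C δ Δ N^{9+ε}`, from Thm 2 (2.12),
  `∀ ε > 0, ∃ C, ∀ N ≥ 1, A₆(N, 1/N², 1/N) ≤ C N^{6+ε}`, by the rescaling), and the equivalence of the
  two printed statements (the converse, Thm 2 = Cor. 3 at `(δ, Δ) = (1/N², 1/N)`, is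
  `Literature.NumberTheory.LFunctions.Bourgain2017_theorem2_of_corollary3` in the main file).

## References

* J. Bourgain, *Decoupling, exponential sums and the Riemann zeta function*, J. Amer. Math. Soc.
  30 (2017), 205–224, doi:10.1090/jams/860, arXiv:1408.5794 — Theorem 2 (2.12), Corollary 3 (2.28)
  ("Using the notation from [H], Theorem 2 implies Corollary 3", §3, after (2.27)).
-/

noncomputable section

open Complex MeasureTheory Finset
open scoped Real

namespace Literature.NumberTheory.LFunctions

/-- The sum `x ↦ ∑_{1 ≤ n ≤ N} e(…)` of (2.28) is continuous in `x ∈ ℝ⁴`. [folklore] -/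
theorem continuous_bourgainA6Sum (N : ℕ) (δ Δ : ℝ) : Continuous (bourgainA6Sum N δ Δ) := by
  unfold bourgainA6Sum bourgainA6Phase
  fun_prop

/-- The integrand `|∑|¹²` of `A₆(N, δ, Δ)` is integrable on the box, so `bourgainA6` is a genuine
Lebesgue integral (not the junk value `0` of a non-integrable integrand). [folklore] -/
theorem integrableOn_bourgainA6_integrand (N : ℕ) (δ Δ : ℝ) :
    IntegrableOn (fun x => ‖bourgainA6Sum N δ Δ x‖ ^ 12) bourgainA6Box := by
  unfold bourgainA6Box
  exact ((continuous_bourgainA6Sum N δ Δ).norm.pow 12).continuousOn.integrableOn_compact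
    isCompact_Icc

/-- Sanity value: with a single unimodular term (`N = 1`), `A₆(1, δ, Δ) = 4`, the measure of the
box. [folklore] -/
theorem bourgainA6_one (δ Δ : ℝ) : bourgainA6 1 δ Δ = 4 := by
  unfold bourgainA6
  have h : ∀ x, ‖bourgainA6Sum 1 δ Δ x‖ ^ 12 = 1 := by
    intro x
    unfold bourgainA6Sum
    rw [show Finset.Icc 1 1 = {1} from rfl, Finset.sum_singleton,
      show (2 * ↑π * I * ↑(bourgainA6Phase 1 δ Δ x 1) : ℂ) =
        ↑(2 * π * bourgainA6Phase 1 δ Δ x 1) * I by push_cast; ring,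
      Complex.norm_exp_ofReal_mul_I, one_pow]
  simp_rw [h]
  rw [setIntegral_const, volume_real_bourgainA6Box, smul_eq_mul, mul_one]


/-! ## Corollary 3 from Theorem 2: the rescaling `x₃ = δ y₃`, `x₄ = Δ y₄`

Bourgain states Corollary 3 (2.28) as "Using the notation from [H], Theorem 2 implies". The
implication is the change of variables `x₃ = δ y₃`, `x₄ = Δ y₄` in (2.28):
`A₆(N, δ, Δ) = δ Δ ∫_{[0,1]² × [-1/δ,1/δ] × [-1/Δ,1/Δ]} |∑_{n ≤ N} e(n y₁ + n² y₂ + (n/N)^{3/2} y₃ + (n/N)^{1/2} y₄)|¹² dy`;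
the integrand is non-negative and independent of `(δ, Δ)`, the box increases as `1/δ ↑ N²`,
`1/Δ ↑ N`, and at the endpoint `(δ, Δ) = (1/N², 1/N)` the same identity reads
`∫_{[0,1]² × [-N²,N²] × [-N,N]} … = N³ A₆(N, 1/N², 1/N)`. Hence
`A₆(N, δ, Δ) ≤ δ Δ N³ A₆(N, 1/N², 1/N) ≤ C δ Δ N^{9+ε}` by Theorem 2 (2.12). Together with
`Bourgain2017_theorem2_of_corollary3` the two printed statements are equivalent
(`Bourgain2017_corollary3_iff_theorem2`). The rescaling is the linear map
`diag(1, 1, δ⁻¹, Δ⁻¹) = Matrix.toLin' (Matrix.diagonal ![1, 1, δ⁻¹, Δ⁻¹])` of `ℝ⁴`, of determinant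
`δ⁻¹ Δ⁻¹`, and the change of variables is `Real.map_linearMap_volume_pi_eq_smul_volume_pi`.
-/

/-- Coordinates of the rescaling `diag(1, 1, δ⁻¹, Δ⁻¹)`: `x ↦ (x₁, x₂, δ⁻¹ x₃, Δ⁻¹ x₄)`. [folklore] -/
theorem bourgainA6Scale_apply (δ Δ : ℝ) (x : Fin 4 → ℝ) (i : Fin 4) :
    Matrix.toLin' (Matrix.diagonal ![1, 1, δ⁻¹, Δ⁻¹]) x i = ![1, 1, δ⁻¹, Δ⁻¹] i * x i := by
  simp [Matrix.toLin'_apply, Matrix.mulVec_diagonal]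

/-- `det diag(1, 1, δ⁻¹, Δ⁻¹) = δ⁻¹ Δ⁻¹`. [folklore] -/
theorem det_bourgainA6Scale (δ Δ : ℝ) :
    LinearMap.det (Matrix.toLin' (Matrix.diagonal ![(1 : ℝ), 1, δ⁻¹, Δ⁻¹])) = δ⁻¹ * Δ⁻¹ := by
  rw [LinearMap.det_toLin', Matrix.det_diagonal]
  simp [Fin.prod_univ_four]

/-- The phase of (2.28) at `x` is the `(δ, Δ) = (1, 1)` phase at the rescaled point
`(x₁, x₂, δ⁻¹ x₃, Δ⁻¹ x₄)`. [folklore] -/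
theorem bourgainA6Phase_scale (N : ℕ) (δ Δ : ℝ) (x : Fin 4 → ℝ) (n : ℕ) :
    bourgainA6Phase N δ Δ x n =
      bourgainA6Phase N 1 1 (Matrix.toLin' (Matrix.diagonal ![1, 1, δ⁻¹, Δ⁻¹]) x) n := by
  simp only [bourgainA6Phase, bourgainA6Scale_apply, inv_one, one_mul]
  simp
  ring

/-- The sum of (2.28) at `x` is the `(δ, Δ) = (1, 1)` sum at the rescaled point. [folklore] -/
theorem bourgainA6Sum_scale (N : ℕ) (δ Δ : ℝ) (x : Fin 4 → ℝ) :
    bourgainA6Sum N δ Δ x =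
      bourgainA6Sum N 1 1 (Matrix.toLin' (Matrix.diagonal ![1, 1, δ⁻¹, Δ⁻¹]) x) := by
  unfold bourgainA6Sum
  exact Finset.sum_congr rfl fun n _ => by rw [bourgainA6Phase_scale N δ Δ x n]

/-- The rescaling pulls the enlarged box `[0,1]² × [-1/δ,1/δ] × [-1/Δ,1/Δ]` back to the box
`[0,1]² × [-1,1]²` (`δ, Δ > 0`). [folklore] -/
theorem bourgainA6Scale_preimage_Icc {δ Δ : ℝ} (hδ : 0 < δ) (hΔ : 0 < Δ) :
    Matrix.toLin' (Matrix.diagonal ![1, 1, δ⁻¹, Δ⁻¹]) ⁻¹'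
        Set.Icc ![0, 0, -δ⁻¹, -Δ⁻¹] ![1, 1, δ⁻¹, Δ⁻¹] = bourgainA6Box := by
  ext x
  simp only [Set.mem_preimage, bourgainA6Box, Set.mem_Icc, Pi.le_def, Fin.forall_fin_succ]
  simp only [bourgainA6Scale_apply]
  simp
  have hδ' : 0 < δ⁻¹ := inv_pos.mpr hδ
  have hΔ' : 0 < Δ⁻¹ := inv_pos.mpr hΔ
  constructor
  · rintro ⟨⟨h0, h1, h2, h3⟩, ⟨h0', h1', h2', h3'⟩⟩
    refine ⟨⟨h0, h1, ?_, ?_⟩, ⟨h0', h1', ?_, ?_⟩⟩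
    · nlinarith [mul_le_mul_of_nonneg_left h2 hδ.le, mul_inv_cancel₀ hδ.ne']
    · nlinarith [mul_le_mul_of_nonneg_left h3 hΔ.le, mul_inv_cancel₀ hΔ.ne']
    · nlinarith [mul_le_mul_of_nonneg_left h2' hδ.le, mul_inv_cancel₀ hδ.ne']
    · nlinarith [mul_le_mul_of_nonneg_left h3' hΔ.le, mul_inv_cancel₀ hΔ.ne']
  · rintro ⟨⟨h0, h1, h2, h3⟩, ⟨h0', h1', h2', h3'⟩⟩
    refine ⟨⟨h0, h1, ?_, ?_⟩, ⟨h0', h1', ?_, ?_⟩⟩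
    · nlinarith [mul_le_mul_of_nonneg_left h2 hδ'.le]
    · nlinarith [mul_le_mul_of_nonneg_left h3 hΔ'.le]
    · nlinarith [mul_le_mul_of_nonneg_left h2' hδ'.le]
    · nlinarith [mul_le_mul_of_nonneg_left h3' hΔ'.le]

/-- **The rescaling identity**
`A₆(N, δ, Δ) = δ Δ ∫_{[0,1]² × [-1/δ,1/δ] × [-1/Δ,1/Δ]} |∑_{n ≤ N} e(n y₁ + n² y₂ + (n/N)^{3/2} y₃ + (n/N)^{1/2} y₄)|¹² dy`
(`δ, Δ > 0`): the substitution `x₃ = δ y₃`, `x₄ = Δ y₄` in (2.28). [folklore] -/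
theorem bourgainA6_eq_mul_setIntegral (N : ℕ) {δ Δ : ℝ} (hδ : 0 < δ) (hΔ : 0 < Δ) :
    bourgainA6 N δ Δ = δ * Δ *
      ∫ y in Set.Icc ![0, 0, -δ⁻¹, -Δ⁻¹] ![1, 1, δ⁻¹, Δ⁻¹], ‖bourgainA6Sum N 1 1 y‖ ^ 12 := by
  have hdet := det_bourgainA6Scale δ Δ
  have hdet0 : LinearMap.det (Matrix.toLin' (Matrix.diagonal ![(1 : ℝ), 1, δ⁻¹, Δ⁻¹])) ≠ 0 := by
    rw [hdet]; positivity
  have hmap := Real.map_linearMap_volume_pi_eq_smul_volume_pi hdet0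
  have hfm : Measurable (Matrix.toLin' (Matrix.diagonal ![(1 : ℝ), 1, δ⁻¹, Δ⁻¹])) :=
    (LinearMap.continuous_of_finiteDimensional _).measurable
  have hg : Continuous fun y => ‖bourgainA6Sum N 1 1 y‖ ^ 12 :=
    (continuous_bourgainA6Sum N 1 1).norm.pow 12
  have key := setIntegral_map (μ := volume) (s := Set.Icc ![0, 0, -δ⁻¹, -Δ⁻¹] ![1, 1, δ⁻¹, Δ⁻¹])
    (g := Matrix.toLin' (Matrix.diagonal ![(1 : ℝ), 1, δ⁻¹, Δ⁻¹]))
    (f := fun y => ‖bourgainA6Sum N 1 1 y‖ ^ 12) measurableSet_Icc hg.aestronglyMeasurable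
    hfm.aemeasurable
  rw [hmap, Measure.restrict_smul, integral_smul_measure, bourgainA6Scale_preimage_Icc hδ hΔ,
    hdet] at key
  have habs : (ENNReal.ofReal |(δ⁻¹ * Δ⁻¹)⁻¹|).toReal = δ * Δ := by
    rw [ENNReal.toReal_ofReal (abs_nonneg _), mul_inv, inv_inv, inv_inv,
      abs_of_pos (mul_pos hδ hΔ)]
  rw [habs, smul_eq_mul] at key
  have hA : bourgainA6 N δ Δ = ∫ x in bourgainA6Box,
      ‖bourgainA6Sum N 1 1 (Matrix.toLin' (Matrix.diagonal ![1, 1, δ⁻¹, Δ⁻¹]) x)‖ ^ 12 := by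
    unfold bourgainA6
    refine setIntegral_congr_fun measurableSet_Icc fun x _ => ?_
    rw [bourgainA6Sum_scale N δ Δ x]
  rw [hA, ← key]

/-- The rescaled box integral is monotone in the box (the integrand is non-negative and
continuous). [folklore] -/
theorem bourgainA6_setIntegral_mono (N : ℕ) {U V U' V' : ℝ} (hU : U ≤ U') (hV : V ≤ V') :
    ∫ y in Set.Icc ![0, 0, -U, -V] ![1, 1, U, V], ‖bourgainA6Sum N 1 1 y‖ ^ 12 ≤
      ∫ y in Set.Icc ![0, 0, -U', -V'] ![1, 1, U', V'], ‖bourgainA6Sum N 1 1 y‖ ^ 12 := by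
  refine setIntegral_mono_set ?_ ?_ ?_
  · exact ((continuous_bourgainA6Sum N 1 1).norm.pow 12).continuousOn.integrableOn_compact
      isCompact_Icc
  · exact ae_of_all _ fun y => by positivity
  · refine (Set.Icc_subset_Icc ?_ ?_).eventuallyLE
    · intro i
      fin_cases i <;> simp [hU, hV]
    · intro i
      fin_cases i <;> simp [hU, hV]

/-- The rescaling identity at the endpoint `(δ, Δ) = (1/N², 1/N)` of Corollary 3, where (2.28)
is Theorem 2 (2.12): `∫_{[0,1]² × [-N²,N²] × [-N,N]} |∑ …|¹² = N³ · A₆(N, 1/N², 1/N)` (`N ≥ 1`).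
[folklore] -/
theorem bourgainA6_setIntegral_endpoint {N : ℕ} (hN : 1 ≤ N) :
    ∫ y in Set.Icc ![0, 0, -(N : ℝ) ^ 2, -(N : ℝ)] ![1, 1, (N : ℝ) ^ 2, (N : ℝ)],
        ‖bourgainA6Sum N 1 1 y‖ ^ 12 =
      (N : ℝ) ^ 3 * bourgainA6 N (1 / (N : ℝ) ^ 2) (1 / N) := by
  have hNpos : (0 : ℝ) < N := by exact_mod_cast hN
  rw [bourgainA6_eq_mul_setIntegral N (by positivity) (by positivity), one_div, one_div, inv_inv,
    inv_inv]
  field_simp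

/-- **Corollary 3 from Theorem 2** ("Using the notation from [H], Theorem 2 implies
Corollary 3. Let `1/N² ≤ δ ≤ 1`, `1/N ≤ Δ ≤ 1`. Then `A₆(N, δ, Δ) = ∫₀¹∫₀¹∫₋₁¹∫₋₁¹ |∑_{n ≤ N} e(n x₁ +`
`n² x₂ + (1/δ)(n/N)^{3/2} x₃ + (1/Δ)(n/N)^{1/2} x₄)|¹² dx ≪ δ Δ N^{9+ε}` (2.28)"):
`A₆(N, δ, Δ) = δ Δ ∫_{[0,1]²×[-1/δ,1/δ]×[-1/Δ,1/Δ]} ≤ δ Δ ∫_{[0,1]²×[-N²,N²]×[-N,N]} = δ Δ N³ A₆(N, 1/N², 1/N) ≤ C δ Δ N^{9+ε}`,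
with the constant `C = C(ε)` of Theorem 2. The hypothesis is the printed Theorem 2 (2.12),
"`∫₀¹∫₀¹∫₋₁¹∫₋₁¹ |∑_{n ≤ N} e(n x₁ + n² x₂ + N^{1/2} n^{3/2} x₃ + N^{1/2} n^{1/2} x₄)|¹² dx ≪ N^{6+ε}`",
i.e. `A₆(N, 1/N², 1/N) ≤ C(ε) N^{6+ε}` for `N ≥ 1` (phase identification
`bourgainA6Phase_theorem2`); the conclusion is the printed Corollary 3 (2.28), for every `ε > 0` a
constant depending on `ε` only, uniform in `N ≥ 1` and in `δ, Δ` in the printed ranges. Both are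
written out explicitly (no named fact: the common content is the paper's decoupling theorem, see the
module docstring). [cite: BourgainJAMS2017, Corollary 3, eq. (2.28); Theorem 2, eq. (2.12)] -/
theorem Bourgain2017_corollary3_of_theorem2
    (h : ∀ ε : ℝ, 0 < ε → ∃ C : ℝ, ∀ N : ℕ, 1 ≤ N →
      bourgainA6 N (1 / (N : ℝ) ^ 2) (1 / N) ≤ C * (N : ℝ) ^ (6 + ε)) :
    ∀ ε : ℝ, 0 < ε → ∃ C : ℝ, ∀ N : ℕ, 1 ≤ N → ∀ δ Δ : ℝ,
      1 / (N : ℝ) ^ 2 ≤ δ → δ ≤ 1 → 1 / (N : ℝ) ≤ Δ → Δ ≤ 1 →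
        bourgainA6 N δ Δ ≤ C * δ * Δ * (N : ℝ) ^ (9 + ε) := by
  intro ε hε
  obtain ⟨C, hC⟩ := h ε hε
  refine ⟨C, fun N hN δ Δ hδl _hδu hΔl _hΔu => ?_⟩
  have hNpos : (0 : ℝ) < N := by exact_mod_cast hN
  have hδ : 0 < δ := lt_of_lt_of_le (by positivity) hδl
  have hΔ : 0 < Δ := lt_of_lt_of_le (by positivity) hΔl
  have h1 : δ⁻¹ ≤ (N : ℝ) ^ 2 := by
    rw [inv_le_comm₀ hδ (by positivity), ← one_div]; exact hδl
  have h2 : Δ⁻¹ ≤ (N : ℝ) := by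
    rw [inv_le_comm₀ hΔ hNpos, ← one_div]; exact hΔl
  have hmono := bourgainA6_setIntegral_mono N h1 h2
  have hT := hC N hN
  have hδΔ : 0 ≤ δ * Δ := by positivity
  calc bourgainA6 N δ Δ
      = δ * Δ * ∫ y in Set.Icc ![0, 0, -δ⁻¹, -Δ⁻¹] ![1, 1, δ⁻¹, Δ⁻¹],
          ‖bourgainA6Sum N 1 1 y‖ ^ 12 := bourgainA6_eq_mul_setIntegral N hδ hΔ
    _ ≤ δ * Δ * ∫ y in Set.Icc ![0, 0, -(N : ℝ) ^ 2, -(N : ℝ)] ![1, 1, (N : ℝ) ^ 2, (N : ℝ)],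
          ‖bourgainA6Sum N 1 1 y‖ ^ 12 := by gcongr
    _ = δ * Δ * (N : ℝ) ^ 3 * bourgainA6 N (1 / (N : ℝ) ^ 2) (1 / N) := by
        rw [bourgainA6_setIntegral_endpoint hN]; ring
    _ ≤ δ * Δ * (N : ℝ) ^ 3 * (C * (N : ℝ) ^ (6 + ε)) := by gcongr
    _ = C * δ * Δ * (N : ℝ) ^ (9 + ε) := by
        have e : (N : ℝ) ^ (9 + ε) = (N : ℝ) ^ ((3 : ℕ) : ℝ) * (N : ℝ) ^ (6 + ε) := by
          rw [← Real.rpow_add hNpos]; congr 1; push_cast; ring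
        rw [e, Real.rpow_natCast]; ring

/-- **Corollary 3 ⟺ Theorem 2**: Bourgain's Corollary 3 (2.28),
`∀ ε > 0, ∃ C, ∀ N ≥ 1, ∀ δ ∈ [1/N², 1], ∀ Δ ∈ [1/N, 1], A₆(N, δ, Δ) ≤ C δ Δ N^{9+ε}`, is equivalent to
the printed Theorem 2 (2.12), `∀ ε > 0, ∃ C, ∀ N ≥ 1, A₆(N, 1/N², 1/N) ≤ C N^{6+ε}` (Theorem 2 is
the endpoint `(δ, Δ) = (1/N², 1/N)`, `Bourgain2017_theorem2_of_corollary3`; the converse is the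
rescaling above). Both statements written out explicitly.
[cite: BourgainJAMS2017, Theorem 2, eq. (2.12) and Corollary 3, eq. (2.28)] -/
theorem Bourgain2017_corollary3_iff_theorem2 :
    (∀ ε : ℝ, 0 < ε → ∃ C : ℝ, ∀ N : ℕ, 1 ≤ N → ∀ δ Δ : ℝ,
      1 / (N : ℝ) ^ 2 ≤ δ → δ ≤ 1 → 1 / (N : ℝ) ≤ Δ → Δ ≤ 1 →
        bourgainA6 N δ Δ ≤ C * δ * Δ * (N : ℝ) ^ (9 + ε)) ↔
      ∀ ε : ℝ, 0 < ε → ∃ C : ℝ, ∀ N : ℕ, 1 ≤ N →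
        bourgainA6 N (1 / (N : ℝ) ^ 2) (1 / N) ≤ C * (N : ℝ) ^ (6 + ε) :=
  ⟨fun h ε hε => Bourgain2017_theorem2_of_corollary3 h ε hε, Bourgain2017_corollary3_of_theorem2⟩

end Literature.NumberTheory.LFunctions
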